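import Literature.AlgebraicGeometry.Frobenioids.ArchimedeanClausesB
import HarnessLib

/-!
# Frobenioids II, Example 3.3 (ii): [FrdI] Def. 1.3 (iii)(c) and (vi) for `C₀` — base-identity endomorphisms

Mochizuki, *The geometry of Frobenioids II: poly-Frobenioids*, Kyushu J. Math. **62** (2008)
401–460, §3, Example 3.3 (ii), author's text p. 28 [cite: MochizukiFrdII2008, Ex 3.3 (ii) p.28];
clauses of [FrdI] Def. 1.3 (found's `Frobenioid.lean`) for abc-iut-L1-t6's `C₀ → F_{Φ₀}`.
PROOF-ONLY file (no definition).  In `C₀` a base-identity linear endomorphism of `(K, B, λ)` is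
`(𝟙, 1, a)` with `(a/|a|) · B ⊆ B` and `|a| ≤ 1` (`endo_conditions`, `endo_mapsTo`).  Contents (all
PROVED): (iii)(c) a co-angular pre-step `φ = (f, 1, c) : A → B` induces the isomorphism
`O^▷(A) ⥲ O^▷(B)`, `(𝟙, 1, a) ↦ (𝟙, 1, f(a))`, characterised by `φ ∘ α = β ∘ φ` (`iii_c`), and the
`β` so attached to `α` depends only on `Base(φ)` (`iii_c_base`); (vi) two co-angular pre-steps
`A → B` with the same base and the same `Div` differ by a unit `(𝟙, 1, a) ∈ O^×(B)`, `|a| = 1` (`vi`).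
-/

namespace Literature.AlgebraicGeometry.Frobenioids

open CategoryTheory Set Function Topology
open scoped Pointwise

noncomputable section

namespace ArchFrd

namespace C0

variable {X Y Z : C0}

/-! ### Base-identity linear endomorphisms of `C₀` -/

/-- The data of a base-identity linear endomorphism `(𝟙, 1, a)`: `(a/|a|) · B ⊆ B` and `|a| ≤ 1`.
[cite: MochizukiFrdII2008, Ex 3.3 (ii) p.28] -/
theorem endo_conditions (α : X ⟶ X) (hb : Base α = 𝟙 X.base) (hd : degFr α = 1) :
    unitPart ℂ (scalar α) • X.region.dir ⊆ X.region.dir ∧ ‖(scalar α : ℂ)‖ ≤ 1 := by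
  obtain ⟨A', hA'c, hA't, hA'd, -⟩ := exists_pulledRegion X (Base α)
  rw [hb, twist_id_image] at hA'd
  obtain ⟨h₁, h₂⟩ := hom_conditions α hA'c
  rw [hd, PNat.one_coe, pow_one, hA'd] at h₁
  rw [hd, PNat.one_coe, pow_one, hA't, ← tip_eq] at h₂
  exact ⟨h₁, (mul_le_iff_le_one_left X.tip_pos).mp h₂⟩

/-- Conversely, such data satisfy the defining inclusion of an arrow `(𝟙, 1, a)`.
[cite: MochizukiFrdII2008, Ex 3.3 (ii) p.28] -/
theorem endo_mapsTo (X : C0) {a : ℂˣ} (hdir : unitPart ℂ a • X.region.dir ⊆ X.region.dir)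
    (hn : ‖(a : ℂ)‖ ≤ 1) :
    a • X.region.carrier ^ ((1 : ℕ+) : ℕ) ⊆ pullRegion X (𝟙 X.base) := by
  rw [pullRegion_id]
  show a • X.region.carrier ^ (0 + 1) ⊆ X.region.carrier
  refine (X.region.smul_carrier_pow_subset_iff X.region a 0).2 ⟨?_, ?_⟩
  · rw [zero_add, pow_one]
    exact hdir
  · rw [X.region.absHom_mul_pow_le_iff X.region a, zero_add, pow_one, ← tip_eq]
    exact (mul_le_iff_le_one_left X.tip_pos).mpr hn

/-- Transport of the angular condition along a co-angular pre-step `(f, 1, c) : A → B`: if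
`(a/|a|) · B_A ⊆ B_A` then `(f(a)/|f(a)|) · B_B ⊆ B_B`. [cite: MochizukiFrdII2008, Ex 3.3 (ii) p.28] -/
theorem dir_transport (φ : X ⟶ Y) (hφ : PreFrobenioid.IsCoAngularPreStep toElem φ) {a : ℂˣ}
    (hdir : unitPart ℂ a • X.region.dir ⊆ X.region.dir) :
    unitPart ℂ ((Base φ).act a) • Y.region.dir ⊆ Y.region.dir := by
  rcases D0.isReal_or_isComplex X.base with hX | hX
  · rw [show Y.region.dir = univ from isNaivelyIsotropic_of_isRealObj (isRealObj_of_hom φ hX)]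
    exact Set.subset_univ _
  · have hφn := isNaivelyCoAngular_of_isCoAngular φ hφ.1 hX
    rw [image_unitPart_homImage, image_unitPart_pullRegion, show degFr φ = 1 from hφ.2.1,
      PNat.one_coe, pow_one] at hφn
    -- `(a/|a|) · τ(B_B) ⊆ τ(B_B)`, then twist
    have h1 : unitPart ℂ a • ((fun z : normOneSubgroup ℂ => unitPart ℂ ((Base φ).act (z : ℂˣ))) ''
        Y.region.dir) ⊆ (fun z : normOneSubgroup ℂ => unitPart ℂ ((Base φ).act (z : ℂˣ))) ''
          Y.region.dir := by
      rw [← hφn, smul_comm]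
      exact Set.smul_set_mono hdir
    have h2 := Set.image_mono
      (f := fun z : normOneSubgroup ℂ => unitPart ℂ ((Base φ).act (z : ℂˣ))) h1
    rwa [twist_image_smul, twist_image_twist_image, ← unitPart_galAct] at h2

/-- The same transport backwards (`f` is an involution on scalars).
[cite: MochizukiFrdII2008, Ex 3.3 (ii) p.28] -/
theorem dir_transport' (φ : X ⟶ Y) (hφ : PreFrobenioid.IsCoAngularPreStep toElem φ) {b : ℂˣ}
    (hdir : unitPart ℂ b • Y.region.dir ⊆ Y.region.dir) :
    unitPart ℂ ((Base φ).act b) • X.region.dir ⊆ X.region.dir := by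
  rcases D0.isReal_or_isComplex X.base with hX | hX
  · rw [show X.region.dir = univ from isNaivelyIsotropic_of_isRealObj hX]
    exact Set.subset_univ _
  · have hφn := isNaivelyCoAngular_of_isCoAngular φ hφ.1 hX
    rw [image_unitPart_homImage, image_unitPart_pullRegion, show degFr φ = 1 from hφ.2.1,
      PNat.one_coe, pow_one] at hφn
    have hXd : X.region.dir = (unitPart ℂ (scalar φ))⁻¹ •
        (fun z : normOneSubgroup ℂ => unitPart ℂ ((Base φ).act (z : ℂˣ))) '' Y.region.dir := by
      rw [← hφn, inv_smul_smul]
    have h2 := Set.image_mono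
      (f := fun z : normOneSubgroup ℂ => unitPart ℂ ((Base φ).act (z : ℂˣ))) hdir
    rw [twist_image_smul, ← unitPart_galAct] at h2
    rw [hXd, smul_comm]
    exact Set.smul_set_mono h2

/-! ### Def. 1.3 (iii)(c) -/

/-- **Def. 1.3 (iii)(c) for `C₀`**: a co-angular pre-step `φ = (f, 1, c) : A → B` induces an
isomorphism of monoids `O^▷(A) ⥲ O^▷(B)`, `(𝟙, 1, a) ↦ (𝟙, 1, f(a))`, with `φ ∘ α = β ∘ φ`.
[cite: MochizukiFrdII2008, Ex 3.3 (ii) p.28] -/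
theorem iii_c (φ : X ⟶ Y) (hφ : PreFrobenioid.IsCoAngularPreStep toElem φ) :
    ∃ e : PreFrobenioid.endSubmonoid toElem X ≃* PreFrobenioid.endSubmonoid toElem Y,
      ∀ α : PreFrobenioid.endSubmonoid toElem X,
        φ ≫ (show Y ⟶ Y from (e α).1) = (show X ⟶ X from α.1) ≫ φ := by
  have hdφ : degFr φ = 1 := hφ.2.1
  haveI : IsIso (Base φ) := hφ.2.2
  -- the data of the forward and backward maps
  have fwd_maps : ∀ α : PreFrobenioid.endSubmonoid toElem X,
      (Base φ).act (scalar (show X ⟶ X from α.1)) • Y.region.carrier ^ ((1 : ℕ+) : ℕ) ⊆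
        pullRegion Y (𝟙 Y.base) := fun α => by
    have hb : Base (show X ⟶ X from α.1) = 𝟙 X.base := α.2.1
    have hd : degFr (show X ⟶ X from α.1) = 1 := α.2.2
    obtain ⟨h1, h2⟩ := endo_conditions (show X ⟶ X from α.1) hb hd
    exact endo_mapsTo Y (dir_transport φ hφ h1) (by rwa [D0.norm_galAct])
  have bwd_maps : ∀ β : PreFrobenioid.endSubmonoid toElem Y,
      (Base φ).act (scalar (show Y ⟶ Y from β.1)) • X.region.carrier ^ ((1 : ℕ+) : ℕ) ⊆
        pullRegion X (𝟙 X.base) := fun β => by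
    have hb : Base (show Y ⟶ Y from β.1) = 𝟙 Y.base := β.2.1
    have hd : degFr (show Y ⟶ Y from β.1) = 1 := β.2.2
    obtain ⟨h1, h2⟩ := endo_conditions (show Y ⟶ Y from β.1) hb hd
    exact endo_mapsTo X (dir_transport' φ hφ h1) (by rwa [D0.norm_galAct])
  have fwd_mem : ∀ α : PreFrobenioid.endSubmonoid toElem X,
      (Base φ).act (scalar (show X ⟶ X from α.1)) ∈ D0.scalars Y.base := fun α => by
    rw [← D0.act_inv (Base φ)]
    exact act_mem_scalars _ (show X ⟶ X from α.1).scalar_mem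
  have bwd_mem : ∀ β : PreFrobenioid.endSubmonoid toElem Y,
      (Base φ).act (scalar (show Y ⟶ Y from β.1)) ∈ D0.scalars X.base := fun β =>
    act_mem_scalars _ (show Y ⟶ Y from β.1).scalar_mem
  let fwd : PreFrobenioid.endSubmonoid toElem X → PreFrobenioid.endSubmonoid toElem Y := fun α =>
    ⟨(⟨𝟙 Y.base, 1, _, fwd_mem α, fwd_maps α⟩ : Y ⟶ Y),
      show PreFrobenioid.IsBaseIdentity toElem _ ∧ PreFrobenioid.IsLinear toElem _ from ⟨rfl, rfl⟩⟩
  let bwd : PreFrobenioid.endSubmonoid toElem Y → PreFrobenioid.endSubmonoid toElem X := fun β =>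
    ⟨(⟨𝟙 X.base, 1, _, bwd_mem β, bwd_maps β⟩ : X ⟶ X),
      show PreFrobenioid.IsBaseIdentity toElem _ ∧ PreFrobenioid.IsLinear toElem _ from ⟨rfl, rfl⟩⟩
  refine ⟨{ toFun := fwd, invFun := bwd, left_inv := ?_, right_inv := ?_, map_mul' := ?_ }, ?_⟩
  · intro α
    have hb : Base (show X ⟶ X from α.1) = 𝟙 X.base := α.2.1
    have hd : degFr (show X ⟶ X from α.1) = 1 := α.2.2
    apply Subtype.ext
    change (show X ⟶ X from (bwd (fwd α)).1) = (show X ⟶ X from α.1)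
    refine hom_ext ?_ ?_ ?_
    · rw [hb]
    · rw [hd]
    · change (Base φ).act ((Base φ).act (scalar (show X ⟶ X from α.1))) = _
      exact D0.galAct_galAct _ _
  · intro β
    have hb : Base (show Y ⟶ Y from β.1) = 𝟙 Y.base := β.2.1
    have hd : degFr (show Y ⟶ Y from β.1) = 1 := β.2.2
    apply Subtype.ext
    change (show Y ⟶ Y from (fwd (bwd β)).1) = (show Y ⟶ Y from β.1)
    refine hom_ext ?_ ?_ ?_
    · rw [hb]
    · rw [hd]
    · change (Base φ).act ((Base φ).act (scalar (show Y ⟶ Y from β.1))) = _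
      exact D0.galAct_galAct _ _
  · intro α α'
    have hb' : Base (show X ⟶ X from α'.1) = 𝟙 X.base := α'.2.1
    have hd : degFr (show X ⟶ X from α.1) = 1 := α.2.2
    apply Subtype.ext
    change (show Y ⟶ Y from (fwd (α * α')).1) =
      (show Y ⟶ Y from (fwd α').1) ≫ (show Y ⟶ Y from (fwd α).1)
    refine hom_ext ?_ ?_ ?_
    · change 𝟙 Y.base = 𝟙 Y.base ≫ 𝟙 Y.base
      exact (Category.id_comp _).symm
    · change (1 : ℕ+) = 1 * 1
      exact (mul_one 1).symm
    · change (Base φ).act (scalar ((show X ⟶ X from α'.1) ≫ (show X ⟶ X from α.1))) =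
        (𝟙 Y.base : Y.base ⟶ Y.base).act ((Base φ).act (scalar (show X ⟶ X from α.1))) *
          (Base φ).act (scalar (show X ⟶ X from α'.1)) ^ ((1 : ℕ+) : ℕ)
      rw [scalar_comp', hb', hd, PNat.one_coe, pow_one, pow_one, map_mul]
      change (Base φ).act (D0.galAct (D0.Hom.twists (𝟙 X.base)) _) * _ =
        D0.galAct (D0.Hom.twists (𝟙 Y.base)) _ * _
      rw [D0.twists_id, D0.twists_id, D0.galAct_false, D0.galAct_false]
  · intro α
    have hb : Base (show X ⟶ X from α.1) = 𝟙 X.base := α.2.1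
    have hd : degFr (show X ⟶ X from α.1) = 1 := α.2.2
    change φ ≫ (show Y ⟶ Y from (fwd α).1) = (show X ⟶ X from α.1) ≫ φ
    refine hom_ext ?_ ?_ ?_
    · change Base φ ≫ 𝟙 Y.base = Base (show X ⟶ X from α.1) ≫ Base φ
      rw [hb, Category.id_comp, Category.comp_id]
    · change degFr φ * 1 = degFr (show X ⟶ X from α.1) * degFr φ
      rw [hd, mul_one, one_mul]
    · change (Base φ).act ((Base φ).act (scalar (show X ⟶ X from α.1))) * scalar φ ^ ((1 : ℕ+) : ℕ) =
        (Base (show X ⟶ X from α.1)).act (scalar φ) *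
          scalar (show X ⟶ X from α.1) ^ (degFr φ : ℕ)
      rw [D0.galAct_galAct, hb, hdφ, PNat.one_coe, pow_one, pow_one]
      change _ = D0.galAct (D0.Hom.twists (𝟙 X.base)) (scalar φ) * _
      rw [D0.twists_id, D0.galAct_false, mul_comm]

/-- **Def. 1.3 (iii)(c), dependence on `Base(φ)` only, for `C₀`**: the `β ∈ O^▷(B)` with
`φ ∘ α = β ∘ φ` has scalar `f(a)` where `f = Base(φ)`, hence is the same for `φ'` with
`Base(φ') = Base(φ)`. [cite: MochizukiFrdII2008, Ex 3.3 (ii) p.28] -/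
theorem iii_c_base (φ φ' : X ⟶ Y) (hφ : PreFrobenioid.IsCoAngularPreStep toElem φ)
    (hφ' : PreFrobenioid.IsCoAngularPreStep toElem φ') (hb : Base φ = Base φ')
    (α : PreFrobenioid.endSubmonoid toElem X) (β β' : PreFrobenioid.endSubmonoid toElem Y)
    (e₁ : φ ≫ (show Y ⟶ Y from β.1) = (show X ⟶ X from α.1) ≫ φ)
    (e₂ : φ' ≫ (show Y ⟶ Y from β'.1) = (show X ⟶ X from α.1) ≫ φ') : β = β' := by
  have hbα : Base (show X ⟶ X from α.1) = 𝟙 X.base := α.2.1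
  -- the scalar of `β` is `f(a)`
  have key : ∀ (ψ : X ⟶ Y), PreFrobenioid.IsCoAngularPreStep toElem ψ →
      ∀ γ : PreFrobenioid.endSubmonoid toElem Y,
        ψ ≫ (show Y ⟶ Y from γ.1) = (show X ⟶ X from α.1) ≫ ψ →
          scalar (show Y ⟶ Y from γ.1) = (Base ψ).act (scalar (show X ⟶ X from α.1)) := by
    intro ψ hψ γ e
    have hdγ : degFr (show Y ⟶ Y from γ.1) = 1 := γ.2.2
    have h := congrArg scalar e
    rw [scalar_comp', scalar_comp', hbα, hdγ, show degFr ψ = 1 from hψ.2.1, PNat.one_coe, pow_one,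
      pow_one] at h
    change (Base ψ).act _ * scalar ψ = D0.galAct (D0.Hom.twists (𝟙 X.base)) (scalar ψ) * _ at h
    rw [D0.twists_id, D0.galAct_false, mul_comm] at h
    have h' := mul_left_cancel h
    rw [← h', D0.galAct_galAct]
  apply Subtype.ext
  change (show Y ⟶ Y from β.1) = (show Y ⟶ Y from β'.1)
  have hb₁ : Base (show Y ⟶ Y from β.1) = 𝟙 Y.base := β.2.1
  have hb₂ : Base (show Y ⟶ Y from β'.1) = 𝟙 Y.base := β'.2.1
  have hd₁ : degFr (show Y ⟶ Y from β.1) = 1 := β.2.2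
  have hd₂ : degFr (show Y ⟶ Y from β'.1) = 1 := β'.2.2
  refine hom_ext (hb₁.trans hb₂.symm) (hd₁.trans hd₂.symm) ?_
  rw [key φ hφ β e₁, key φ' hφ' β' e₂, hb]

/-! ### Def. 1.3 (vi) -/

/-- **Def. 1.3 (vi) for `C₀`**: co-angular pre-steps `φ = (f, 1, c)`, `ψ = (f, 1, c')` with the same
base and the same `Div` (so `|c| = |c'|`) differ by the unit `(𝟙, 1, f(c c'⁻¹)) ∈ O^×(B)`.
[cite: MochizukiFrdII2008, Ex 3.3 (ii) p.28] -/
theorem vi (φ ψ : X ⟶ Y) (hφ : PreFrobenioid.IsCoAngularPreStep toElem φ)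
    (hψ : PreFrobenioid.IsCoAngularPreStep toElem ψ) (hb : PreFrobenioid.BaseEquivalent toElem φ ψ)
    (hm : PreFrobenioid.MetricallyEquivalent toElem φ ψ) :
    ∃ α ∈ PreFrobenioid.unitsSubgroup toElem Y, ψ ≫ α.hom = φ := by
  have hdφ : degFr φ = 1 := hφ.2.1
  have hdψ : degFr ψ = 1 := hψ.2.1
  haveI : IsIso (Base ψ) := hψ.2.2
  change Base φ = Base ψ at hb
  -- `|c| = |c'|`
  have hnorm : ‖(scalar φ : ℂ)‖ = ‖(scalar ψ : ℂ)‖ := by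
    have h : ratio φ = ratio ψ := by
      have := congrArg (fun x : Multiplicative NNReal => ((Multiplicative.toAdd x : NNReal) : ℝ)) hm
      simp only [pf_div, coe_toAdd_div] at this
      exact Real.log_injOn_pos (ratio_pos φ) (ratio_pos ψ) this
    unfold ratio at h
    rw [hdφ, hdψ, PNat.one_coe, pow_one] at h
    have hY := Y.tip_pos
    have hX := X.tip_pos
    have h1 : 0 < ‖(scalar φ : ℂ)‖ := norm_pos_iff.mpr (scalar φ).ne_zero
    have h2 : 0 < ‖(scalar ψ : ℂ)‖ := norm_pos_iff.mpr (scalar ψ).ne_zero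
    rw [div_eq_div_iff (mul_pos h1 hX).ne' (mul_pos h2 hX).ne'] at h
    exact (mul_right_cancel₀ hX.ne' (mul_left_cancel₀ hY.ne' h)).symm
  -- the unit `a = f(c c'⁻¹)`
  obtain ⟨a, ha⟩ : ∃ a : ℂˣ, a = (Base ψ).act (scalar φ * (scalar ψ)⁻¹) := ⟨_, rfl⟩
  have han : ‖(a : ℂ)‖ = 1 := by
    rw [ha, D0.norm_galAct, Units.val_mul, norm_mul, Units.val_inv_eq_inv_val, norm_inv, hnorm,
      mul_inv_cancel₀ (norm_ne_zero_iff.mpr (scalar ψ).ne_zero)]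
  have hamem : a ∈ D0.scalars Y.base := by
    rw [ha, ← D0.act_inv (Base ψ)]
    exact act_mem_scalars _ (mul_mem φ.scalar_mem (inv_mem ψ.scalar_mem))
  -- angular condition: `(a/|a|) · B_B = B_B`
  have hdir : unitPart ℂ a • Y.region.dir = Y.region.dir := by
    rcases D0.isReal_or_isComplex X.base with hX | hX
    · rw [show Y.region.dir = univ from isNaivelyIsotropic_of_isRealObj (isRealObj_of_hom φ hX)]
      exact Set.smul_set_univ
    · have hφn := isNaivelyCoAngular_of_isCoAngular φ hφ.1 hX
      have hψn := isNaivelyCoAngular_of_isCoAngular ψ hψ.1 hX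
      rw [image_unitPart_homImage, image_unitPart_pullRegion, hdφ, PNat.one_coe, pow_one, hb] at hφn
      rw [image_unitPart_homImage, image_unitPart_pullRegion, hdψ, PNat.one_coe, pow_one] at hψn
      -- `(u_c u_c'⁻¹) · τ(B) = τ(B)`
      have h1 : (unitPart ℂ (scalar φ) * (unitPart ℂ (scalar ψ))⁻¹) •
          ((fun z : normOneSubgroup ℂ => unitPart ℂ ((Base ψ).act (z : ℂˣ))) '' Y.region.dir) =
            (fun z : normOneSubgroup ℂ => unitPart ℂ ((Base ψ).act (z : ℂˣ))) '' Y.region.dir := by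
        conv_lhs => rw [← hψn, smul_smul, inv_mul_cancel_right, hφn]
      have h2 := congrArg
        (Set.image fun z : normOneSubgroup ℂ => unitPart ℂ ((Base ψ).act (z : ℂˣ))) h1
      rw [twist_image_smul, twist_image_twist_image, ← unitPart_inv, ← unitPart_mul,
        ← unitPart_galAct] at h2
      rw [ha]
      exact h2
  -- the unit `α = (𝟙, 1, a)`
  obtain ⟨α, hαb, hαd, hαc⟩ := exists_hom Y Y (𝟙 Y.base) 1 (c := a) hamem (A' := Y.region)
    (by rw [pullRegion_id]) (by rw [PNat.one_coe, pow_one]; exact hdir.le)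
    (by rw [han, one_mul, PNat.one_coe, pow_one, tip_eq])
  haveI : IsIso (Base α) := by rw [hαb]; infer_instance
  haveI : IsIso α := by
    refine isIso_of α hαd ?_
    rw [hαb, pullRegion_id, hαc]
    have habs : absHom ℂ a = 1 := Subtype.ext (by rw [coe_absHom, han, Positive.val_one])
    have h := smul_carrier_pow_eq Y.region Y.region a 0 (by rw [zero_add, pow_one, hdir])
      (by rw [habs, one_mul, zero_add, pow_one])
    rwa [zero_add, pow_one] at h
  refine ⟨asIso α, show PreFrobenioid.IsBaseIdentity toElem (asIso α).hom ∧
    PreFrobenioid.IsLinear toElem (asIso α).hom from ⟨hαb, hαd⟩, hom_ext ?_ ?_ ?_⟩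
  · change Base ψ ≫ Base α = Base φ
    rw [hαb, Category.comp_id, hb]
  · change degFr ψ * degFr α = degFr φ
    rw [hαd, hdψ, hdφ, mul_one]
  · change (Base ψ).act (scalar α) * scalar ψ ^ (degFr α : ℕ) = scalar φ
    rw [hαc, hαd, PNat.one_coe, pow_one, ha, D0.galAct_galAct, inv_mul_cancel_right]

end C0

end ArchFrd

end

end Literature.AlgebraicGeometry.Frobenioids
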